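import Literature.MathematicalPhysics.QuantumLattice.FlatBandFerromagnetism
import HarnessLib

/-!
# Flat-band ferromagnetism on Tasaki's decorated chain (the `d = 1` example of Tasaki 1998, §6.2)

Topic `MathematicalPhysics/QuantumLattice` (Hubbard family; rigorous ferromagnetism). The simplest
instance of the cell construction of [Tasaki 1998, §6.1–§6.2] (`FlatBandFerromagnetism.lean`): the
decorated ring with periodic boundary conditions built from `L` triangular cells (lattice (a) of
[Tasaki 1998, Figure (f:flat)], "`(d+1)L^d` sites" with `d = 1`). Sites are `Fin (2L)`; the EXTERNAL
sites are the even ones `2k` (the ring `ℤ/L`), the INTERNAL sites are the odd ones `2k+1` (the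
decorating site at the centre of the bond `{2k, 2k+2}`), and the cell of `2k+1` is `{2k, 2k+2 mod 2L}`.
The hopping matrix is `cellHopping`, `t_{xy} = t Σ_{i odd} λ^{(i)}_x λ^{(i)}_y`; for `L ≥ 3` this is
exactly [Tasaki 1998, eq. (6.5)] with `d = 1` (`λt` between an internal site and its two external
neighbours, `t` between next-nearest external sites, on-site `λ²t` resp. `2t`). Electron number
`N_e = |E| = L` (filling `ν = 1/4`).

Main result `decoratedChain_ferromagnetism`: for every `L`, `t > 0`, `λ ≠ 0`, `U > 0` the conclusions
of [Tasaki 1998, Theorem 6.1] hold for this model — obtained from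
`FlatBand.flatBand_ferromagnetism` by checking the two structural hypotheses: cells of internal
sites consist of external sites (`decoratedChain_cell_subset`) and the external sites are connected
through the cells (`cellGraph_decoratedChain_preconnected`). This also witnesses that the hypotheses
of the abstract theorem are satisfiable by a genuine short-range model.

## References

* H. Tasaki, Prog. Theor. Phys. **99** (1998) 489–548 = arXiv:cond-mat/9712219, §6.2 (examples,
  eq. (6.5)), Theorem 6.1. [Tasaki1998PTP]
* H. Tasaki, Phys. Rev. Lett. **69** (1992) 1608. [Tasaki1992]
-/

noncomputable section

open Matrix Finset
open scoped ComplexOrder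

namespace Literature.MathematicalPhysics.QuantumLattice

namespace FlatBand

namespace DecoratedChain

/-- The external sites of the decorated ring on `Fin (2L)`: the even sites `2k`, `k < L`
(the `L`-site ring). [cite: Tasaki1998PTP, §6.2 ("the set `E` of external sites can be identified
with the `d`-dimensional `L × ⋯ × L` hypercubic lattice")] -/
def ext (L : ℕ) : Finset (Fin (2 * L)) := univ.filter fun x => Even x.val

/-- The cells: the internal (odd) site `2k+1` decorates the bond `{2k, 2k+2}` of the ring (indices
mod `2L`); only the values at internal sites matter. [cite: Tasaki1998PTP, §6.2 ("the internal sites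
are the decorating sites at the center of every bond")] -/
def cell (L : ℕ) (i : Fin (2 * L)) : Finset (Fin (2 * L)) :=
  univ.filter fun y => Even y.val ∧ (y.val + 1 = i.val ∨ (i.val + 1) % (2 * L) = y.val)

/-- The Hubbard Hamiltonian of the decorated chain: hopping `t Σ_{i odd} λ^{(i)}_x λ^{(i)}_y`
(= [Tasaki 1998, eq. (6.5)] with `d = 1` for `L ≥ 3`) plus `U Σ n_{x↑} n_{x↓}`.
[cite: Tasaki1998PTP, §6.2, eq. (6.5)] -/
def hamiltonian (L : ℕ) (t lam U : ℝ) : Matrix (Finset (Orb (Fin (2 * L)))) (Finset (Orb (Fin (2 * L)))) ℂ :=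
  FlatBand.hamiltonian (ext L) (cell L) t lam U

/-- Membership in `ext`. [cite: Tasaki1998PTP, §6.2] -/
theorem mem_ext_iff {L : ℕ} (x : Fin (2 * L)) : x ∈ ext L ↔ Even x.val := by
  simp [ext]

/-- Cells consist of external sites. [cite: Tasaki1998PTP, §6.1–§6.2 (cells = one internal site and
its external sites)] -/
theorem decoratedChain_cell_subset (L : ℕ) (i : Fin (2 * L)) : cell L i ⊆ ext L := by
  intro y hy
  rw [cell, mem_filter] at hy
  exact (mem_ext_iff y).2 hy.2.1

/-- The external sites are `2k`, `k < L`; there are `L` of them (`N_e = L^d`, `d = 1`).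
[cite: Tasaki1998PTP, §6.2 ("the electron number specified in Theorem 6.1 is `N_e = L^d`")] -/
theorem card_ext (L : ℕ) : (ext L).card = L := by
  have h : ext L = (univ : Finset (Fin L)).map
      ⟨fun k => (⟨2 * k.val, by omega⟩ : Fin (2 * L)), fun a b hab => by
        apply Fin.ext
        have := congrArg Fin.val hab
        simp only at this
        omega⟩ := by
    ext x
    rw [mem_ext_iff, mem_map]
    constructor
    · intro hx
      obtain ⟨k, hk⟩ := even_iff_two_dvd.1 hx
      exact ⟨⟨k, by omega⟩, mem_univ _, Fin.ext (by simp [hk])⟩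
    · rintro ⟨k, -, rfl⟩
      exact even_two_mul _
  rw [h, card_map, card_univ, Fintype.card_fin]

/-- One step along the ring: the external sites `2k` and `2k+2` are adjacent in the cell graph
(through the internal site `2k+1`). [cite: Tasaki1998PTP, §6.1 ("the whole lattice is connected via
nonvanishing `t_{xy}`")] -/
private theorem reachable_zero_two_mul (L k : ℕ) (hk : 2 * k < 2 * L) :
    (cellGraph (ext L) (cell L)).Reachable
      ⟨⟨0, by omega⟩, (mem_ext_iff _).2 (by simp)⟩
      ⟨⟨2 * k, hk⟩, (mem_ext_iff _).2 (even_two_mul k)⟩ := by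
  induction k with
  | zero => exact SimpleGraph.Reachable.refl _
  | succ k ih =>
    have hk' : 2 * k < 2 * L := by omega
    refine (ih hk').trans (SimpleGraph.Adj.reachable ?_)
    rw [cellGraph_adj_iff]
    refine ⟨fun h => ?_, ⟨2 * k + 1, by omega⟩, ?_, ?_, ?_⟩
    · have := congrArg (fun v : ↥(ext L) => (v : Fin (2 * L)).val) h
      simp only at this
      omega
    · rw [mem_ext_iff]
      exact Nat.not_even_two_mul_add_one k
    · rw [cell, mem_filter]
      exact ⟨mem_univ _, even_two_mul k, Or.inl rfl⟩
    · rw [cell, mem_filter]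
      refine ⟨mem_univ _, even_two_mul (k + 1), Or.inr ?_⟩
      simp only
      rw [Nat.mod_eq_of_lt (by omega)]
      ring

/-- **Connectivity**: the external sites of the decorated ring are connected through the cells.
[cite: Tasaki1998PTP, §6.1 ("we finally assume that the whole lattice is connected via nonvanishing
`t_{xy}`") and §6.2] -/
theorem cellGraph_decoratedChain_preconnected (L : ℕ) :
    (cellGraph (ext L) (cell L)).Preconnected := by
  have key : ∀ y : ↥(ext L), (cellGraph (ext L) (cell L)).Reachable
      ⟨⟨0, by have := y.1.isLt; omega⟩, (mem_ext_iff _).2 (by simp)⟩ y := by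
    intro y
    obtain ⟨k, hk⟩ := even_iff_two_dvd.1 ((mem_ext_iff _).1 y.2)
    have hlt : 2 * k < 2 * L := hk ▸ y.1.isLt
    have hy : y = ⟨⟨2 * k, hlt⟩, (mem_ext_iff _).2 (even_two_mul k)⟩ :=
      Subtype.ext (Fin.ext hk)
    rw [hy]
    exact reachable_zero_two_mul L k hlt
  intro y z
  exact (key y).symm.trans (key z)

/-- **Flat-band ferromagnetism of Tasaki's decorated chain** ([Tasaki 1998, Theorem 6.1] for the
`d = 1` example of §6.2): for every `L`, `t > 0`, `λ ≠ 0`, `U > 0`, with `N_e = L` electrons on the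
`2L`-site decorated ring, the ground-state energy is `0`, every ground state has
`S = S_max = L/2` (`S² ψ = (L/2)(L/2 + 1) ψ`), and the ground multiplet has dimension exactly `L + 1`.
[cite: Tasaki1998PTP, §6.2 with Theorem 6.1] -/
theorem decoratedChain_ferromagnetism (L : ℕ) {t lam U : ℝ} (ht : 0 < t) (hlam : lam ≠ 0)
    (hU : 0 < U) :
    groundEnergy (hamiltonian L t lam U) L = 0 ∧
      (∀ ψ : Fock (Orb (Fin (2 * L))), IsGroundState (hamiltonian L t lam U) L ψ →
        spinSq *ᵥ ψ = ((((L : ℝ) / 2) * ((L : ℝ) / 2 + 1) : ℝ) : ℂ) • ψ) ∧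
      Module.finrank ℂ ↥(LinearMap.ker (Matrix.toLin' (hamiltonian L t lam U -
          ((groundEnergy (hamiltonian L t lam U) L : ℝ) : ℂ) • 1)) ⊓
        LinearMap.ker (Matrix.toLin'
          (totalNumber - (L : ℂ) • (1 : Matrix (Finset (Orb (Fin (2 * L)))) _ ℂ)))) = L + 1 := by
  have h := flatBand_ferromagnetism (ext L) (cell L) (t := t) (lam := lam) (U := U)
    (fun i _ => decoratedChain_cell_subset L i) (cellGraph_decoratedChain_preconnected L) ht hlam hU
  rw [card_ext] at h
  exact h

end DecoratedChain

end FlatBand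

end Literature.MathematicalPhysics.QuantumLattice
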